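import Summits.ResolutionOfSingularities.ResolutionOfSingularities.Theorems.MarkedTransferCampaignW46MohWindowSurfaceCentreChild
import Summits.ResolutionOfSingularities.ResolutionOfSingularities.Theorems.MarkedTransferCampaignW46MohWindowSurfacePureChildStep
import Summits.ResolutionOfSingularities.ResolutionOfSingularities.Theorems.MarkedTransferCampaignW46MohWindowSurfacePermissible
import Summits.ResolutionOfSingularities.ResolutionOfSingularities.Theorems.MarkedTransferCampaignW46MohWindowSurfaceHeavyInsep
import HarnessLib

/-!
# [OURS · L1 W4.6 rung (iii-2), HEAVY-ROOT SIDE, `p = 2`] Surface Moh window — TERMINATION OF EVERY PERMISSIBLE SEQUENCE in the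
# purely inseparable surface window at `p = 2` (cell res-hironaka, LADDER-RESOLUTION rung L, D-0089; seat res-L1-s46-pv-5 gen 4;
# host MarkedTransfer, `--supports stmt-ResolutionOfSingularities-16155 --as helper`; statement file `…CampaignW46MohWindowSurface.lean`)

HONEST FRAMING. Nothing here is a statement of H. Hironaka's manuscript [Hironaka2017] and nothing here asserts that any
statement of it holds. THEOREMS about the OURS regime `CampaignW46.Regime.mohWindowSurface` (o1, §5: `E.b = p`, `Sing(E)` finite
closed, a coefficient window presentation at every singular point, at EVERY stage) at `p = 2`, where the window is `{d = 3}` and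
tameness is void (every tame state is terminal, `…Freeze.lean`): the NON-TAME rung, closed by the «p = 2 programme» of
res-L1-s46-pv-5 (NOTES): `…Freeze*` (rigidity), `…FormTransfer` (residue-form transfer), `…FrozenShape`, `…CubeChild`,
`…CubeCentre`, `…CentreChild`, `…PureChild[Step]`. AI-written; AI review is weaker than expert review. No `sorry`; axioms standard.

WHAT IS PROVED. `permissiblyTerminates_mohWindowSurface_two`: `PermissiblyTerminates (Regime.mohWindowSurface)` for `p = 2` and
EVERY field `K` of characteristic `2` — there is NO infinite §2.1-permissible sequence of point blow-ups all of whose stages lie in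
the coefficient surface-window regime; hence (`terminates_…`) the typed Th. 16.6 procedure has no infinite run there, for every
notion instance `N` and reading `Rd`. MECHANISM (no secondary invariant of Hauser–Wagner type is needed at `p = 2`): attach to a
singular point the WEIGHT `0` if its window ideal has the FROZEN shape, `1` if it has the PURE cube-child shape, `2` otherwise;
weights are transported off the centre (stalk isomorphism), a centre is never frozen (`not_mohWindowSurface_transform_of_frozen_centre`),
the children of a weight-`2` centre have weight `≤ 1` (`frozen_or_pure_of_over_centre`) and the children of a pure centre have
weight `0` (`exists_frozenShape_of_over_pure`); so the multiset of weights over `Sing(E)` drops in the Dershowitz–Manna order at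
every step (pattern of res-D-pv-050's `…Permissible.lean`). (VAC): not vacuous — e.g. from the cube point `z² + y³ + x⁵`
(`E₈`-like) an in-regime sequence runs cube point → pure child → frozen grandchild (hand computation, not kernel-checked here);
res-D-pv-029's instance `z² + x³ + y³` is frozen at once (`X³ + Y³ = (X+Y)(X²+XY+Y²)` over `𝔽₂`). [ZariskiSamuel1960] [Matsumura1987]
[HauserWagner2014]
-/

noncomputable section

set_option linter.dupNamespace false -- mandated namespace of this single-conjunct summit

open CategoryTheory AlgebraicGeometry TopologicalSpace IsLocalRing

namespace Summit.ResolutionOfSingularities.ResolutionOfSingularities.Theorems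

namespace CampaignW46

open Literature.AlgebraicGeometry.Resolution
open Literature.AlgebraicGeometry.Hironaka2017.S02Preliminaries
open Literature.AlgebraicGeometry.Hironaka2017.Datum
open Literature.AlgebraicGeometry.Hironaka2017.S16Proof
open Scheme.IdealSheafData

universe u

namespace MohWindowSurfaceTwo

/-! ## 1. Ring level: the two shapes are transported by ring isomorphisms -/

section Transport

variable {L L' : Type u} [CommRing L] [IsLocalRing L] [CommRing L'] [IsLocalRing L']

/-- A ring isomorphism of local rings maps the maximal ideal onto the maximal ideal. [folklore] -/
theorem map_maximalIdeal_ringEquiv (e : L ≃+* L') : (maximalIdeal L).map (e : L →+* L') = maximalIdeal L' := by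
  apply le_antisymm
  · intro y hy
    rw [Ideal.mem_map_iff_of_surjective (e : L →+* L') e.surjective] at hy
    obtain ⟨x, hx, rfl⟩ := hy
    refine (mem_maximalIdeal _).mpr (mem_nonunits_iff.mpr fun hu => ?_)
    exact ((mem_maximalIdeal _).mp hx) ((isUnit_map_iff (e : L →+* L') x).mp hu)
  · intro y hy
    have : y = (e : L →+* L') (e.symm y) := by simp
    rw [this]
    refine Ideal.mem_map_of_mem _ ((mem_maximalIdeal _).mpr (mem_nonunits_iff.mpr fun hu => ?_))
    exact ((mem_maximalIdeal _).mp hy) (by simpa using (hu.map (e : L →+* L')))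

/-- Transport of a generating triple of the maximal ideal. [folklore] -/
theorem span_triple_map_ringEquiv (e : L ≃+* L') {s q w : L} (h : Ideal.span {s, q, w} = maximalIdeal L) :
    Ideal.span {e s, e q, e w} = maximalIdeal L' := by
  rw [← map_maximalIdeal_ringEquiv e, ← h, Ideal.map_span, Set.image_insert_eq, Set.image_insert_eq, Set.image_singleton]
  rfl

/-- Transport of membership in a power of the maximal ideal. [folklore] -/
theorem map_mem_pow_ringEquiv (e : L ≃+* L') {a : L} {k : ℕ} (h : a ∈ maximalIdeal L ^ k) : e a ∈ maximalIdeal L' ^ k := by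
  have := Ideal.mem_map_of_mem (e : L →+* L') h
  rwa [Ideal.map_pow, map_maximalIdeal_ringEquiv] at this

/-- **Transport of the FROZEN shape** along a ring isomorphism `e` with `J′ = e(J)`. [folklore] -/
theorem frozen_map_ringEquiv (e : L ≃+* L') {J : Ideal L}
    (h : ∃ s q w η r η_S η_Q η_W : L, Ideal.span {s, q, w} = maximalIdeal L ∧
      η - (η_S * s + η_Q * q + η_W * w) ∈ maximalIdeal L ^ 2 ∧ IsUnit η_Q ∧ r ∈ maximalIdeal L ^ 4 ∧
      J = Ideal.span {w ^ 2 + (s ^ 2 * η + r)}) :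
    ∃ s q w η r η_S η_Q η_W : L', Ideal.span {s, q, w} = maximalIdeal L' ∧
      η - (η_S * s + η_Q * q + η_W * w) ∈ maximalIdeal L' ^ 2 ∧ IsUnit η_Q ∧ r ∈ maximalIdeal L' ^ 4 ∧
      J.map (e : L →+* L') = Ideal.span {w ^ 2 + (s ^ 2 * η + r)} := by
  obtain ⟨s, q, w, η, r, η_S, η_Q, η_W, hgen, hη, hQ, hr, hJ⟩ := h
  refine ⟨e s, e q, e w, e η, e r, e η_S, e η_Q, e η_W, span_triple_map_ringEquiv e hgen, ?_, hQ.map e, map_mem_pow_ringEquiv e hr,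
    ?_⟩
  · have := map_mem_pow_ringEquiv e hη
    simpa only [map_sub, map_add, map_mul] using this
  · rw [hJ, Ideal.map_span, Set.image_singleton]
    simp only [RingHom.coe_coe, map_add, map_pow, map_mul]

/-- **Transport of the PURE cube-child shape** along a ring isomorphism `e` with `J′ = e(J)`. [folklore] -/
theorem pure_map_ringEquiv (e : L ≃+* L') {J : Ideal L}
    (h : ∃ s q w η G η_S η_Q η_W : L, Ideal.span {s, q, w} = maximalIdeal L ∧
      η - (η_S * s + η_Q * q + η_W * w) ∈ maximalIdeal L ^ 2 ∧ IsUnit η_S ∧ η_Q ∈ maximalIdeal L ∧ IsUnit G ∧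
      J = Ideal.span {w ^ 2 + (s ^ 2 * η + s * q ^ 3 * G)}) :
    ∃ s q w η G η_S η_Q η_W : L', Ideal.span {s, q, w} = maximalIdeal L' ∧
      η - (η_S * s + η_Q * q + η_W * w) ∈ maximalIdeal L' ^ 2 ∧ IsUnit η_S ∧ η_Q ∈ maximalIdeal L' ∧ IsUnit G ∧
      J.map (e : L →+* L') = Ideal.span {w ^ 2 + (s ^ 2 * η + s * q ^ 3 * G)} := by
  obtain ⟨s, q, w, η, G, η_S, η_Q, η_W, hgen, hη, hS, hQ, hG, hJ⟩ := h
  refine ⟨e s, e q, e w, e η, e G, e η_S, e η_Q, e η_W, span_triple_map_ringEquiv e hgen, ?_, hS.map e, ?_, hG.map e, ?_⟩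
  · have := map_mem_pow_ringEquiv e hη
    simpa only [map_sub, map_add, map_mul] using this
  · have := map_mem_pow_ringEquiv e (k := 1) (by rw [pow_one]; exact hQ)
    rwa [pow_one] at this
  · rw [hJ, Ideal.map_span, Set.image_singleton]
    simp only [RingHom.coe_coe, map_add, map_pow, map_mul]

end Transport

end MohWindowSurfaceTwo

/-! ## 2. One permissible blow-up drops a multiset of weights (abstract Dershowitz–Manna step) -/

section Campaign

variable {K : Type u} [Field K] [CharP K 2]
variable {A A' : AmbientDatum 2 K} {E : IdealExponent A.Z}

/-- **Abstract Dershowitz–Manna step** (the pattern of res-D-pv-050's `isDershowitzMannaLT_of_isPermissibleCentre`, the valuation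
made a parameter): for a permissible blow-up with `Sing(E)` a finite set of closed points and `Sing(E′)` finite, and weights
`val, val′` that are TRANSPORTED off the centre and DROP over it, the multiset of weights over `Sing(E′)` is `<_DM` the one over
`Sing(E)`. [folklore] -/
theorem isDershowitzMannaLT_of_val {D : Closeds A.Z} (π : A'.Z ⟶ A.Z)
    (hπ : IsBlowup π (vanishingIdeal D)) (hD : E.IsPermissibleCentre A.hom D) (hfin : E.sing.Finite)
    (hcl : E.sing ⊆ Literature.AlgebraicGeometry.Hironaka2017.S02Preliminaries.closedPoints A.Z)
    (hfin' : (E.transform π D).sing.Finite) (val : A.Z → ℕ) (val' : A'.Z → ℕ)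
    (hoff : ∀ x' ∈ (E.transform π D).sing, π.base x' ∉ (D : Set A.Z) → val' x' = val (π.base x'))
    (hon : ∀ x' ∈ (E.transform π D).sing, π.base x' ∈ (D : Set A.Z) → val' x' < val (π.base x')) :
    Multiset.IsDershowitzMannaLT ((hfin'.toFinset.val).map val') ((hfin.toFinset.val).map val) := by
  classical
  obtain ⟨ξ, hξS, hξcl, hDξ⟩ := IsPermissibleCentre.exists_eq_singleton_of_isolatedSing hD ⟨hfin, hcl⟩
  set S : Finset A.Z := hfin.toFinset with hS
  set S' : Finset A'.Z := hfin'.toFinset with hS'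
  set Son : Finset A'.Z := S'.filter fun x' => π.base x' = ξ with hSon
  set Soff : Finset A'.Z := S'.filter fun x' => ¬ π.base x' = ξ with hSoff
  have hξmem : ξ ∈ S := by rw [hS, Set.Finite.mem_toFinset]; exact hξS
  have hmemS' : ∀ x', x' ∈ S' ↔ x' ∈ (E.transform π D).sing := fun x' => by rw [hS', Set.Finite.mem_toFinset]
  -- split `M = X + Y`
  have hsplit : S'.val.map val' = Soff.val.map val' + Son.val.map val' := by
    rw [← Multiset.map_add, hSoff, hSon, Finset.filter_val, Finset.filter_val, add_comm, Multiset.filter_add_not]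
  -- off the centre: `X ≤` the multiset of `E` without the blown-up point
  have hoffD : ∀ x' ∈ Soff, π.base x' ∉ (D : Set A.Z) := fun x' hx' => by
    rw [hSoff, Finset.mem_filter] at hx'
    rw [hDξ]; exact hx'.2
  have hinj : Set.InjOn π.base (Soff : Set A'.Z) :=
    (MohWindow.injOn_preimage_compl hπ).mono fun x' hx' => hoffD x' hx'
  have himage : Soff.image π.base ⊆ S.erase ξ := by
    intro η hη
    obtain ⟨x', hx', rfl⟩ := Finset.mem_image.mp hη
    have hx'S : x' ∈ (E.transform π D).sing := (hmemS' x').mp (Finset.mem_filter.mp hx').1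
    refine Finset.mem_erase.mpr ⟨?_, ?_⟩
    · have := hoffD x' hx'; rw [hDξ] at this; exact this
    · rw [hS, Set.Finite.mem_toFinset]
      exact MohWindowSurfacePermissible.base_mem_sing_of_not_over_centre π hπ hx'S (hoffD x' hx')
  have hXle : Soff.val.map val' ≤ (S.erase ξ).val.map val := by
    have h1 : Soff.val.map val' = (Soff.val.map π.base).map val := by
      rw [Multiset.map_map]
      refine Multiset.map_congr rfl fun x' hx' => ?_
      have hx'' : x' ∈ Soff := hx'
      simp only [Function.comp_apply]
      exact hoff x' ((hmemS' x').mp (Finset.mem_filter.mp hx'').1) (hoffD x' hx'')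
    rw [h1, ← Finset.image_val_of_injOn hinj]
    exact Multiset.map_le_map (Finset.val_le_iff.mpr himage)
  have hSval : S.val.map val = (S.erase ξ).val.map val + {val ξ} := by
    conv_lhs => rw [← Finset.insert_erase hξmem]
    rw [Finset.insert_val_of_notMem (Finset.notMem_erase ξ S), Multiset.map_cons, add_comm, Multiset.singleton_add]
  have hXleN : Soff.val.map val' ≤ S.val.map val := by
    rw [hSval]; exact hXle.trans (Multiset.le_add_right _ _)
  have hZ : S.val.map val - Soff.val.map val' = ((S.erase ξ).val.map val - Soff.val.map val') + {val ξ} := by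
    rw [hSval, add_comm ((S.erase ξ).val.map val), add_tsub_assoc_of_le hXle, add_comm]
  refine ⟨Soff.val.map val', Son.val.map val', S.val.map val - Soff.val.map val', ?_, hsplit, ?_, ?_⟩
  · rw [hZ]
    exact fun h => by simpa using congrArg (fun m => val ξ ∈ m) h
  · rw [add_tsub_cancel_of_le hXleN]
  · intro y hy
    obtain ⟨x', hx', rfl⟩ := Multiset.mem_map.mp hy
    have hx'f := Finset.mem_filter.mp hx'
    have hx'S : x' ∈ (E.transform π D).sing := (hmemS' x').mp hx'f.1
    refine ⟨val ξ, ?_, ?_⟩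
    · rw [hZ]; exact Multiset.mem_add.mpr (Or.inr (Multiset.mem_singleton_self _))
    · have hover : π.base x' ∈ (D : Set A.Z) := by rw [hDξ]; exact hx'f.2
      have := hon x' hx'S hover
      rw [hx'f.2] at this
      exact this



/-! ## 3. The weight: `0` frozen, `1` pure, `2` otherwise -/

open scoped Classical in
/-- The weight is transported by the stalk isomorphism off the centre. [folklore] -/
theorem weight_eq_of_not_over_centre {D : Closeds A.Z} (π : A'.Z ⟶ A.Z) (hπ : IsBlowup π (vanishingIdeal D))
    {x' : A'.Z} (hover : π.base x' ∉ (D : Set A.Z)) :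
    (if ∃ s q w η r η_S η_Q η_W : A'.Z.presheaf.stalk x', Ideal.span {s, q, w} = maximalIdeal _ ∧
        η - (η_S * s + η_Q * q + η_W * w) ∈ maximalIdeal _ ^ 2 ∧ IsUnit η_Q ∧ r ∈ maximalIdeal _ ^ 4 ∧
        stalkIdeal (E.transform π D).J x' = Ideal.span {w ^ 2 + (s ^ 2 * η + r)} then 0
      else if ∃ s q w η G η_S η_Q η_W : A'.Z.presheaf.stalk x', Ideal.span {s, q, w} = maximalIdeal _ ∧
        η - (η_S * s + η_Q * q + η_W * w) ∈ maximalIdeal _ ^ 2 ∧ IsUnit η_S ∧ η_Q ∈ maximalIdeal _ ∧ IsUnit G ∧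
        stalkIdeal (E.transform π D).J x' = Ideal.span {w ^ 2 + (s ^ 2 * η + s * q ^ 3 * G)} then 1 else 2) =
    (if ∃ s q w η r η_S η_Q η_W : A.Z.presheaf.stalk (π.base x'), Ideal.span {s, q, w} = maximalIdeal _ ∧
        η - (η_S * s + η_Q * q + η_W * w) ∈ maximalIdeal _ ^ 2 ∧ IsUnit η_Q ∧ r ∈ maximalIdeal _ ^ 4 ∧
        stalkIdeal E.J (π.base x') = Ideal.span {w ^ 2 + (s ^ 2 * η + r)} then 0
      else if ∃ s q w η G η_S η_Q η_W : A.Z.presheaf.stalk (π.base x'), Ideal.span {s, q, w} = maximalIdeal _ ∧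
        η - (η_S * s + η_Q * q + η_W * w) ∈ maximalIdeal _ ^ 2 ∧ IsUnit η_S ∧ η_Q ∈ maximalIdeal _ ∧ IsUnit G ∧
        stalkIdeal E.J (π.base x') = Ideal.span {w ^ 2 + (s ^ 2 * η + s * q ^ 3 * G)} then 1 else 2) := by
  classical
  haveI : IsLocallyNoetherian A'.Z := by
    haveI := A'.smooth
    exact LocallyOfFiniteType.isLocallyNoetherian A'.hom
  have hnot : π.base x' ∉ (vanishingIdeal D).support := by
    rw [← SetLike.mem_coe, coe_support_vanishingIdeal]; exact hover
  have h1 : stalkIdeal (E.transform π D).J x' = (stalkIdeal E.J (π.base x')).map (π.stalkMap x').hom := by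
    show stalkIdeal (controlledTransform π (vanishingIdeal D) E.J E.b) x' = _
    rw [hπ.stalkIdeal_controlledTransform_of_not_mem E.J E.b hnot, stalkIdeal_comap_eq_map_stalkMap]
  haveI := hπ.isIso_stalkMap_of_not_mem_support hnot
  let e : A.Z.presheaf.stalk (π.base x') ≃+* A'.Z.presheaf.stalk x' := (asIso (π.stalkMap x')).commRingCatIsoToRingEquiv
  have he : ((e : A.Z.presheaf.stalk (π.base x') →+* A'.Z.presheaf.stalk x') : _ → _) = (π.stalkMap x').hom := rfl
  have h2 : stalkIdeal (E.transform π D).J x' =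
      (stalkIdeal E.J (π.base x')).map (e : A.Z.presheaf.stalk (π.base x') →+* A'.Z.presheaf.stalk x') := by
    rw [h1]; unfold Ideal.map; rw [he]
  have h3 : stalkIdeal E.J (π.base x') =
      (stalkIdeal (E.transform π D).J x').map (e.symm : A'.Z.presheaf.stalk x' →+* A.Z.presheaf.stalk (π.base x')) := by
    rw [h2, Ideal.map_map]
    have : (e.symm : A'.Z.presheaf.stalk x' →+* A.Z.presheaf.stalk (π.base x')).comp
        (e : A.Z.presheaf.stalk (π.base x') →+* A'.Z.presheaf.stalk x') = RingHom.id _ := by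
      ext a; simp
    rw [this, Ideal.map_id]
  -- the two shapes correspond under `e`
  have hF : (∃ s q w η r η_S η_Q η_W : A'.Z.presheaf.stalk x', Ideal.span {s, q, w} = maximalIdeal _ ∧
        η - (η_S * s + η_Q * q + η_W * w) ∈ maximalIdeal _ ^ 2 ∧ IsUnit η_Q ∧ r ∈ maximalIdeal _ ^ 4 ∧
        stalkIdeal (E.transform π D).J x' = Ideal.span {w ^ 2 + (s ^ 2 * η + r)}) ↔
      (∃ s q w η r η_S η_Q η_W : A.Z.presheaf.stalk (π.base x'), Ideal.span {s, q, w} = maximalIdeal _ ∧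
        η - (η_S * s + η_Q * q + η_W * w) ∈ maximalIdeal _ ^ 2 ∧ IsUnit η_Q ∧ r ∈ maximalIdeal _ ^ 4 ∧
        stalkIdeal E.J (π.base x') = Ideal.span {w ^ 2 + (s ^ 2 * η + r)}) := by
    constructor
    · intro h; rw [h3]; exact MohWindowSurfaceTwo.frozen_map_ringEquiv e.symm h
    · intro h; rw [h2]; exact MohWindowSurfaceTwo.frozen_map_ringEquiv e h
  have hP : (∃ s q w η G η_S η_Q η_W : A'.Z.presheaf.stalk x', Ideal.span {s, q, w} = maximalIdeal _ ∧
        η - (η_S * s + η_Q * q + η_W * w) ∈ maximalIdeal _ ^ 2 ∧ IsUnit η_S ∧ η_Q ∈ maximalIdeal _ ∧ IsUnit G ∧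
        stalkIdeal (E.transform π D).J x' = Ideal.span {w ^ 2 + (s ^ 2 * η + s * q ^ 3 * G)}) ↔
      (∃ s q w η G η_S η_Q η_W : A.Z.presheaf.stalk (π.base x'), Ideal.span {s, q, w} = maximalIdeal _ ∧
        η - (η_S * s + η_Q * q + η_W * w) ∈ maximalIdeal _ ^ 2 ∧ IsUnit η_S ∧ η_Q ∈ maximalIdeal _ ∧ IsUnit G ∧
        stalkIdeal E.J (π.base x') = Ideal.span {w ^ 2 + (s ^ 2 * η + s * q ^ 3 * G)}) := by
    constructor
    · intro h; rw [h3]; exact MohWindowSurfaceTwo.pure_map_ringEquiv e.symm h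
    · intro h; rw [h2]; exact MohWindowSurfaceTwo.pure_map_ringEquiv e h
  simp only [hF, hP]

open scoped Classical in
/-- **The weight drops over an admitted centre** (both stages in the regime): the centre is not frozen; a point over a non-pure,
non-frozen centre is frozen or pure; a point over a pure centre is frozen. [folklore] -/
theorem weight_lt_of_over_centre {D : Closeds A.Z} (π : A'.Z ⟶ A.Z) (hπ : IsBlowup π (vanishingIdeal D))
    (hD : E.IsPermissibleCentre A.hom D) (hRg : Regime.mohWindowSurface A E)
    (hRg' : Regime.mohWindowSurface A' (E.transform π D)) {x' : A'.Z} (hx' : x' ∈ (E.transform π D).sing)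
    (hover : π.base x' ∈ (D : Set A.Z)) :
    (if ∃ s q w η r η_S η_Q η_W : A'.Z.presheaf.stalk x', Ideal.span {s, q, w} = maximalIdeal _ ∧
        η - (η_S * s + η_Q * q + η_W * w) ∈ maximalIdeal _ ^ 2 ∧ IsUnit η_Q ∧ r ∈ maximalIdeal _ ^ 4 ∧
        stalkIdeal (E.transform π D).J x' = Ideal.span {w ^ 2 + (s ^ 2 * η + r)} then 0
      else if ∃ s q w η G η_S η_Q η_W : A'.Z.presheaf.stalk x', Ideal.span {s, q, w} = maximalIdeal _ ∧
        η - (η_S * s + η_Q * q + η_W * w) ∈ maximalIdeal _ ^ 2 ∧ IsUnit η_S ∧ η_Q ∈ maximalIdeal _ ∧ IsUnit G ∧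
        stalkIdeal (E.transform π D).J x' = Ideal.span {w ^ 2 + (s ^ 2 * η + s * q ^ 3 * G)} then 1 else 2) <
    (if ∃ s q w η r η_S η_Q η_W : A.Z.presheaf.stalk (π.base x'), Ideal.span {s, q, w} = maximalIdeal _ ∧
        η - (η_S * s + η_Q * q + η_W * w) ∈ maximalIdeal _ ^ 2 ∧ IsUnit η_Q ∧ r ∈ maximalIdeal _ ^ 4 ∧
        stalkIdeal E.J (π.base x') = Ideal.span {w ^ 2 + (s ^ 2 * η + r)} then 0
      else if ∃ s q w η G η_S η_Q η_W : A.Z.presheaf.stalk (π.base x'), Ideal.span {s, q, w} = maximalIdeal _ ∧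
        η - (η_S * s + η_Q * q + η_W * w) ∈ maximalIdeal _ ^ 2 ∧ IsUnit η_S ∧ η_Q ∈ maximalIdeal _ ∧ IsUnit G ∧
        stalkIdeal E.J (π.base x') = Ideal.span {w ^ 2 + (s ^ 2 * η + s * q ^ 3 * G)} then 1 else 2) := by
  classical
  obtain ⟨ξ, hξS, hξcl, hDξ⟩ := IsPermissibleCentre.exists_eq_singleton_of_isolatedSing hD ⟨hRg.2.1, hRg.2.2.1⟩
  have hπx : π.base x' = ξ := by simpa [hDξ] using hover
  have hcS : π.base x' ∈ E.sing := hπx ▸ hξS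
  -- the centre is not frozen
  have hnotF : ¬ ∃ s q w η r η_S η_Q η_W : A.Z.presheaf.stalk (π.base x'), Ideal.span {s, q, w} = maximalIdeal _ ∧
        η - (η_S * s + η_Q * q + η_W * w) ∈ maximalIdeal _ ^ 2 ∧ IsUnit η_Q ∧ r ∈ maximalIdeal _ ^ 4 ∧
        stalkIdeal E.J (π.base x') = Ideal.span {w ^ 2 + (s ^ 2 * η + r)} := by
    rintro ⟨s, q, w, η, r, η_S, η_Q, η_W, hsqw, hη, hQ, hr, hJ⟩
    exact not_mohWindowSurface_transform_of_frozen_centre π hπ hD hRg hover hcS hsqw hη hQ hr hJ hRg'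
  rw [if_neg hnotF]
  -- the children are frozen or pure
  obtain ⟨s, q, w, η, r, η_S, η_Q, η_W, hsqw, hη, hJ', hcase⟩ := frozen_or_pure_of_over_centre π hπ hD hRg hRg' hx' hover
  by_cases hP : ∃ s q w η G η_S η_Q η_W : A.Z.presheaf.stalk (π.base x'), Ideal.span {s, q, w} = maximalIdeal _ ∧
        η - (η_S * s + η_Q * q + η_W * w) ∈ maximalIdeal _ ^ 2 ∧ IsUnit η_S ∧ η_Q ∈ maximalIdeal _ ∧ IsUnit G ∧
        stalkIdeal E.J (π.base x') = Ideal.span {w ^ 2 + (s ^ 2 * η + s * q ^ 3 * G)}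
  · -- pure centre: every singular point over it is frozen
    rw [if_pos hP]
    obtain ⟨s₀, q₀, w₀, η₀, G₀, ηS₀, ηQ₀, ηW₀, hsqw₀, hη₀, hS₀, hQ₀, hG₀, hJ₀⟩ := hP
    obtain ⟨-, -, s', q', w', G', r', hsqw', hG', hr', hJ''⟩ :=
      exists_frozenShape_of_over_pure π hπ hD hRg hover hsqw₀ hη₀ hS₀ hQ₀ hG₀ hJ₀ hx' rfl
    have hfrozen : ∃ s q w η r η_S η_Q η_W : A'.Z.presheaf.stalk x', Ideal.span {s, q, w} = maximalIdeal _ ∧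
        η - (η_S * s + η_Q * q + η_W * w) ∈ maximalIdeal _ ^ 2 ∧ IsUnit η_Q ∧ r ∈ maximalIdeal _ ^ 4 ∧
        stalkIdeal (E.transform π D).J x' = Ideal.span {w ^ 2 + (s ^ 2 * η + r)} :=
      ⟨s', q', w', G' * q', r', 0, G', 0, hsqw', by
        rw [show G' * q' - (0 * s' + G' * q' + 0 * w') = 0 from by ring]; exact zero_mem _, hG', hr', hJ''⟩
    rw [if_pos hfrozen]
    exact zero_lt_one
  · rw [if_neg hP]
    rcases hcase with ⟨hQ, hr⟩ | ⟨G, hG, rfl, hS, hQ⟩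
    · have hfrozen : ∃ s q w η r η_S η_Q η_W : A'.Z.presheaf.stalk x', Ideal.span {s, q, w} = maximalIdeal _ ∧
          η - (η_S * s + η_Q * q + η_W * w) ∈ maximalIdeal _ ^ 2 ∧ IsUnit η_Q ∧ r ∈ maximalIdeal _ ^ 4 ∧
          stalkIdeal (E.transform π D).J x' = Ideal.span {w ^ 2 + (s ^ 2 * η + r)} :=
        ⟨s, q, w, η, r, η_S, η_Q, η_W, hsqw, hη, hQ, hr, hJ'⟩
      rw [if_pos hfrozen]
      exact two_pos
    · have hpure : ∃ s q w η G η_S η_Q η_W : A'.Z.presheaf.stalk x', Ideal.span {s, q, w} = maximalIdeal _ ∧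
          η - (η_S * s + η_Q * q + η_W * w) ∈ maximalIdeal _ ^ 2 ∧ IsUnit η_S ∧ η_Q ∈ maximalIdeal _ ∧ IsUnit G ∧
          stalkIdeal (E.transform π D).J x' = Ideal.span {w ^ 2 + (s ^ 2 * η + s * q ^ 3 * G)} :=
        ⟨s, q, w, η, G, η_S, η_Q, η_W, hsqw, hη, hS, hQ, hG, hJ'⟩
      by_cases hF : ∃ s q w η r η_S η_Q η_W : A'.Z.presheaf.stalk x', Ideal.span {s, q, w} = maximalIdeal _ ∧
          η - (η_S * s + η_Q * q + η_W * w) ∈ maximalIdeal _ ^ 2 ∧ IsUnit η_Q ∧ r ∈ maximalIdeal _ ^ 4 ∧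
          stalkIdeal (E.transform π D).J x' = Ideal.span {w ^ 2 + (s ^ 2 * η + r)}
      · rw [if_pos hF]; exact two_pos
      · rw [if_neg hF, if_pos hpure]; exact one_lt_two

/-! ## 4. Termination -/

open scoped Classical in
/-- **[OURS · L1 W4.6 rung (iii-2), `p = 2`] EVERY PERMISSIBLE BLOW-UP SEQUENCE INSIDE THE PURELY INSEPARABLE SURFACE WINDOW AT
`p = 2` IS FINITE** (résumé-free; coefficient regime `Regime.mohWindowSurface`, every field of characteristic `2`). NOT a statement of
the manuscript. [folklore] -/
theorem permissiblyTerminates_mohWindowSurface_two :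
    PermissiblyTerminates (Regime.mohWindowSurface (p := 2) (K := K)) := by
  classical
  intro r hr
  let val : (k : ℕ) → (r.A k).Z → ℕ := fun k x =>
    if ∃ s q w η ρ η_S η_Q η_W : (r.A k).Z.presheaf.stalk x, Ideal.span {s, q, w} = maximalIdeal _ ∧
        η - (η_S * s + η_Q * q + η_W * w) ∈ maximalIdeal _ ^ 2 ∧ IsUnit η_Q ∧ ρ ∈ maximalIdeal _ ^ 4 ∧
        stalkIdeal (r.E k).J x = Ideal.span {w ^ 2 + (s ^ 2 * η + ρ)} then 0
      else if ∃ s q w η G η_S η_Q η_W : (r.A k).Z.presheaf.stalk x, Ideal.span {s, q, w} = maximalIdeal _ ∧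
        η - (η_S * s + η_Q * q + η_W * w) ∈ maximalIdeal _ ^ 2 ∧ IsUnit η_S ∧ η_Q ∈ maximalIdeal _ ∧ IsUnit G ∧
        stalkIdeal (r.E k).J x = Ideal.span {w ^ 2 + (s ^ 2 * η + s * q ^ 3 * G)} then 1 else 2
  let M : ℕ → Multiset ℕ := fun k => ((hr k).2.1.toFinset.val).map (val k)
  have hlt : ∀ k, Multiset.IsDershowitzMannaLT (M (k + 1)) (M k) := by
    intro k
    have key : ∀ (E₁ : IdealExponent (r.A (k + 1)).Z) (h₁ : Regime.mohWindowSurface (r.A (k + 1)) E₁)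
        (heq : E₁ = (r.E k).transform (r.π k) (r.D k)),
        Multiset.IsDershowitzMannaLT
          ((h₁.2.1.toFinset.val).map fun x => if ∃ s q w η ρ η_S η_Q η_W : (r.A (k + 1)).Z.presheaf.stalk x,
              Ideal.span {s, q, w} = maximalIdeal _ ∧ η - (η_S * s + η_Q * q + η_W * w) ∈ maximalIdeal _ ^ 2 ∧ IsUnit η_Q ∧
              ρ ∈ maximalIdeal _ ^ 4 ∧ stalkIdeal E₁.J x = Ideal.span {w ^ 2 + (s ^ 2 * η + ρ)} then 0
            else if ∃ s q w η G η_S η_Q η_W : (r.A (k + 1)).Z.presheaf.stalk x, Ideal.span {s, q, w} = maximalIdeal _ ∧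
              η - (η_S * s + η_Q * q + η_W * w) ∈ maximalIdeal _ ^ 2 ∧ IsUnit η_S ∧ η_Q ∈ maximalIdeal _ ∧ IsUnit G ∧
              stalkIdeal E₁.J x = Ideal.span {w ^ 2 + (s ^ 2 * η + s * q ^ 3 * G)} then 1 else 2)
          (M k) := by
      intro E₁ h₁ heq
      subst heq
      exact isDershowitzMannaLT_of_val (r.π k) (r.blowup k) (r.permissible k) (hr k).2.1 (hr k).2.2.1 h₁.2.1 _ _
        (fun x' _ hover => weight_eq_of_not_over_centre (E := r.E k) (r.π k) (r.blowup k) hover)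
        (fun x' hx' hover => weight_lt_of_over_centre (r.π k) (r.blowup k) (r.permissible k) (hr k) h₁ hx' hover)
    exact key (r.E (k + 1)) (hr (k + 1)) (r.E_succ k)
  exact false_of_descending_chain Multiset.wellFounded_isDershowitzMannaLT M hlt

/-- **[OURS · L1 W4.6 rung (iii-2), `p = 2`] The typed Th. 16.6 procedure has NO infinite run inside the purely inseparable surface
window at `p = 2`**, for every notion instance `N` and reading `Rd` (literal centre rule and ∇-centred rule). NOT a statement of
the manuscript. [folklore] -/
theorem terminates_mohWindowSurface_two {n : ℕ} (N : Notions.{u} n) (Rd : Reading 2 K N) :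
    Terminates N Rd (Regime.mohWindowSurface (p := 2) (K := K)) ∧
      TerminatesNabla N Rd (Regime.mohWindowSurface (p := 2) (K := K)) :=
  ⟨terminates_of_permissiblyTerminates N Rd permissiblyTerminates_mohWindowSurface_two,
    terminatesNabla_of_terminates (terminates_of_permissiblyTerminates N Rd permissiblyTerminates_mohWindowSurface_two)⟩


/-! ## 5. The NAMED rung of res-L1-type-o1's statement file at `p = 2` -/

/-- **[OURS · L1 W4.6 rung (iii-2), `p = 2`] THE RÉSUMÉ-FREE PURELY INSEPARABLE SURFACE-WINDOW RUNG HOLDS AT `p = 2`**: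
`MohWindowSurfaceInsepPermissiblyTerminates 2 K` (o1, `…W46MohWindowSurface.lean` §3: NO infinite §2.1-permissible sequence inside
`regimeMohWindowSurfaceInsep` — surface window germ `z² + f`, `2 < ord f < 4`, isolated singular locus, at every stage), for EVERY
field `K` of characteristic `2` (the two regimes coincide, res-D-pv-050's `regimeMohWindowSurfaceInsep_iff_mohWindowSurface`).
NOT a statement of the manuscript. [folklore] -/
theorem mohWindowSurfaceInsepPermissiblyTerminates_two (K : Type u) [Field K] [CharP K 2] :
    MohWindowSurfaceInsepPermissiblyTerminates 2 K :=
  permissiblyTerminates_antitone (fun A E h => (regimeMohWindowSurfaceInsep_iff_mohWindowSurface A E).mp h)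
    permissiblyTerminates_mohWindowSurface_two

/-- **The typed rungs at `p = 2`**: for every notion instance `N` and reading `Rd`, the typed Th. 16.6 procedure (literal centre
rule, and the ∇-centred rule) has no infinite run inside `regimeMohWindowSurfaceInsep` in characteristic `2`. NOT a statement of
the manuscript. [folklore] -/
theorem terminates_mohWindowSurfaceInsep_two (K : Type u) [Field K] [CharP K 2] {n : ℕ} (N : Notions.{u} n)
    (Rd : Reading 2 K N) :
    Terminates N Rd (regimeMohWindowSurfaceInsep (p := 2) (K := K)) ∧
      TerminatesNabla N Rd (regimeMohWindowSurfaceInsep (p := 2) (K := K)) :=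
  terminates_and_terminatesNabla_of_mohWindowSurfaceInsepPermissiblyTerminates
    (mohWindowSurfaceInsepPermissiblyTerminates_two K) n N Rd

end Campaign

end CampaignW46

end Summit.ResolutionOfSingularities.ResolutionOfSingularities.Theorems

end
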